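import Mathlib.MeasureTheory.Integral.DivergenceTheorem
import Mathlib.MeasureTheory.Measure.Haar.InnerProductSpace
import Mathlib.MeasureTheory.Measure.Lebesgue.EqHaar
import Literature.Analysis.FluidPDE.LeiZhang2011
import Literature.Analysis.FluidPDE.KNSSThm53OfWindow
import Literature.Analysis.FluidPDE.BallCutoff
import Literature.Analysis.FluidPDE.BiotSavartCurlPair
import Literature.Analysis.FluidPDE.DivFreeVectorPotential
import Literature.Analysis.FluidPDE.StokesWholeSpacePressure
import HarnessLib

/-!
# Lei–Zhang 2011, Theorem 1.2: the last paragraph of the printed proof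

Analysis/FluidPDE proofs file (everything proved; no definitions, no named facts), sibling of
`Literature.Analysis.FluidPDE.LeiZhang2011`, on the discharge path of the named fact
`Literature.Analysis.FluidPDE.LeiZhang2011_liouville` (Z. Lei, Q. S. Zhang, *A Liouville theorem
for the axially-symmetric Navier–Stokes equations*, J. Funct. Anal. 261 (2011) 2323–2345 =
arXiv:1011.5066, **Theorem 1.2**; proof §4, arXiv p. 12).

The printed proof has three steps: (1) Theorem 1.1 of the paper (Hölder continuity of
`Γ = r v^θ` at the axis, by a Nash–Moser argument for the equation
`∂ₜΓ + b·∇Γ + (2/r)∂ᵣΓ = ΔΓ` with drift in the class `E`) and `L → ∞` give `Γ ≡ Γ(0,0)`, whence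
`v^θ ≡ 0`; (2) Theorem 5.2 of Koch–Nadirashvili–Seregin–Šverák gives `v = (0, 0, l(t))`;
(3) the stream function `B(·, t)` is then `BMO` "and harmonic", hence bounded, hence constant,
so `v = ∇ × B = 0`.

This file proves **steps (2)–(3)** for the tree form of the fact, unconditionally
(`LeiZhang2011_liouville_of_ae_swirl_eq_zero`): step (2) is the tree's theorem
`KNSS2009_liouville_axisymmetric_no_swirl_holds` (`KNSSThm53OfWindow`), and step (3) is
`eq_zero_of_ae_curl_apply_two_eq_of_eBMOSeminormVec_le` below. It also records the resulting
reduction of the whole fact to the output of step (1) (`LeiZhang2011_liouville_of_swirl_step`).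

## Step (3) in the tree form (deviation from the printed argument, and why)

In the tree form the stream slices `B t` are merely *differentiable* with `curl (B t) = u t`
a.e. and `‖B t‖_BMO ≤ C`; they are not assumed divergence free, so the printed
"`ΔB = −∇ × v = 0`, mean value property, Liouville" is not available (and `B t` need not be
`C²`). We use instead the Stokes pairing behind it: if `curl B = l e_z` a.e., then for the
cut-off `φ_R` of the ball `B(0, 3R)` (`ballCutoff 0 R`: `= 1` on `B̄(0, 2R)`, `‖∇φ_R‖ ≤ C₀/R`)
and any constants `a₀, a₁`,
`∫ ((∂₁φ_R)(B₀ − a₀) − (∂₀φ_R)(B₁ − a₁)) = ∫ φ_R (curl B)₂ = l ∫ φ_R ≥ l |B(0, 2R)|`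
(for `l ≥ 0`, say), while with `aᵢ` the averages of `Bᵢ` over `B(0, 4R)` the left side is at
most `(C₀/R) · 2 ‖B‖_BMO |B(0, 4R)|`; so `|l| R ≤ 16 C₀ ‖B‖_BMO` for every `R > 0` and `l = 0`.
The integration by parts for a merely differentiable `B` (whose individual partial derivatives
need not be locally integrable — only the combination `(curl B)₂ = l` is) is Mathlib's
divergence theorem on boxes for the Henstock–Kurzweil-type `GP` integral
(`MeasureTheory.integral_divergence_of_hasFDerivAt_off_countable'`: continuity on the box,
differentiability inside, integrability of the *divergence* only), applied to the field
`φ e_z × B = (−φ B₁, φ B₀, 0)` on a cube containing the support of `φ`, transported from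
`Fin 3 → ℝ` to `EuclideanSpace ℝ (Fin 3)` by `PiLp.volume_preserving_toLp`
(`integral_rotPairing_sub_mul_curl_eq_zero`).

## Main results

* `integral_eq_zero_of_divergence_cube`: Mathlib's `GP`-integral divergence theorem on a cube of
  `Fin 3 → ℝ` for fields vanishing near the boundary, transported to `EuclideanSpace ℝ (Fin 3)`.
* `integral_inner_curl_sub_inner_curl_eq_zero`: `∫ (⟪B, curl Φ⟫ − ⟪curl B, Φ⟫) = 0` for
  differentiable `B`, `Φ ∈ C¹_c(ℝ³; ℝ³)`, integrable integrand — the integration by parts through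
  which the (differentiable, `BMO`) stream slices enter every estimate of §§2–3 of the paper.
* `integral_rotPairing_sub_mul_curl_eq_zero`: `∫ ((∂₁φ) B₀ − (∂₀φ) B₁ − φ (curl B)₂) = 0` for
  differentiable `B`, `φ ∈ C¹` vanishing off a ball, integrable integrand (the case `Φ = φ e_z`).
* `integral_mul_inner_gradient_eq_integral_inner_sub_cross`: the drift term through the stream
  function, `∫ h ⟪V, ∇ψ⟫ = ∫ ⟪B − c, ∇h × ∇ψ⟫` when `curl B = V` a.e. (Lei–Zhang §2, the `b₂`
  term: "`−½∬ b₂·∇f² ψ² = ∬ (B − B̄)·∇×(…)`"), and the pointwise bound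
  `|⟪B − c, ∇h × ∇ψ⟫| ≤ ‖B − c‖ ‖∇h‖ ‖∇ψ‖`.
* `setIntegral_abs_apply_sub_average_le`: `∫_{B(x₀,r)} |Bᵢ − (Bᵢ)_{B(x₀,r)}| ≤ ‖B‖_BMO |B(x₀,r)|`.
* `eq_zero_of_ae_curl_apply_two_eq_of_eBMOSeminormVec_le`: step (3).
* `LeiZhang2011_liouville_of_ae_swirl_eq_zero`: Theorem 1.2 for solutions already known to be
  swirl free a.e. (steps (2)–(3)).
* `LeiZhang2011_liouville_of_swirl_step`: the fact follows from step (1).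

## References

* Z. Lei, Q. S. Zhang, J. Funct. Anal. 261 (2011) 2323–2345 = arXiv:1011.5066, Thm. 1.2 (p. 4),
  proof §4 (p. 12). [LeiZhang2011]
* G. Koch, N. Nadirashvili, G. Seregin, V. Šverák, Acta Math. 203 (2009), Thm. 5.2.
  [KochNadirashviliSereginSverak2009]
-/

noncomputable section

open MeasureTheory Set Function Filter Metric WithLp
open _root_.Topology
open scoped InnerProductSpace RealInnerProductSpace NNReal ENNReal Laplacian

namespace Literature.Analysis.FluidPDE

open Literature.Analysis.FunctionSpaces

/-! ### Integration by parts for the axial curl component of a differentiable field -/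

section Stokes

/-- A coordinate of `y : Fin 3 → ℝ` is bounded by the Euclidean norm of `toLp 2 y`. [folklore] -/
theorem abs_apply_le_norm_toLp (y : Fin 3 → ℝ) (i : Fin 3) : |y i| ≤ ‖toLp 2 y‖ := by
  have h := PiLp.norm_apply_le (toLp 2 y : EuclideanSpace ℝ (Fin 3)) i
  simpa [Real.norm_eq_abs] using h

/-- **The divergence theorem on a cube for a field vanishing near its boundary, transported to
`EuclideanSpace ℝ (Fin 3)`.** If `f₀, f₁, f₂ : (Fin 3 → ℝ) → ℝ` are continuous, differentiable
everywhere with derivatives `f'ᵢ`, vanish wherever `‖toLp 2 y‖ ≥ M`, and their divergence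
`∑ᵢ f'ᵢ(y) eᵢ` is `G (toLp 2 y)` for a function `G` on `ℝ³` that is integrable and vanishes for
`‖x‖ > M`, then `∫ G = 0`: Mathlib's divergence theorem on boxes for the `GP` integral
(`integral_divergence_of_hasFDerivAt_off_countable'`: continuity on the box, differentiability
inside, integrability of the divergence only) on `[−M, M]³`, whose face integrals vanish, and
the volume preserving `toLp` (`PiLp.volume_preserving_toLp`). [folklore] -/
theorem integral_eq_zero_of_divergence_cube {f : Fin 3 → (Fin 3 → ℝ) → ℝ}
    {f' : Fin 3 → (Fin 3 → ℝ) → (Fin 3 → ℝ) →L[ℝ] ℝ} (hfc : ∀ i, Continuous (f i))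
    (hff' : ∀ y i, HasFDerivAt (f i) (f' i y) y) {M : ℝ} (hM : 0 < M)
    (hf0 : ∀ i y, M ≤ ‖(toLp 2 y : EuclideanSpace ℝ (Fin 3))‖ → f i y = 0)
    {G : EuclideanSpace ℝ (Fin 3) → ℝ} (hdiv : ∀ y, ∑ i, f' i y (Pi.single i 1) = G (toLp 2 y))
    (hG0 : ∀ x, M < ‖x‖ → G x = 0)
    (hint : Integrable G (volume : Measure (EuclideanSpace ℝ (Fin 3)))) : ∫ x, G x = 0 := by
  -- `f i` vanishes where some coordinate has absolute value `≥ M`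
  have hf0' : ∀ i (y : Fin 3 → ℝ) (j : Fin 3), M ≤ |y j| → f i y = 0 := fun i y j hy =>
    hf0 i y (hy.trans (abs_apply_le_norm_toLp y j))
  -- the divergence theorem on the cube `[-M, M]³`
  set a : Fin 3 → ℝ := fun _ => -M with ha
  set b : Fin 3 → ℝ := fun _ => M with hb
  have hab : a ≤ b := fun _ => by simp only [ha, hb]; linarith
  have hemb : MeasurableEmbedding (toLp 2 : (Fin 3 → ℝ) → EuclideanSpace ℝ (Fin 3)) :=
    (MeasurableEquiv.toLp 2 (Fin 3 → ℝ)).measurableEmbedding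
  have hpres : MeasurePreserving (toLp 2 : (Fin 3 → ℝ) → EuclideanSpace ℝ (Fin 3)) :=
    PiLp.volume_preserving_toLp (Fin 3)
  have hGint : Integrable (G ∘ toLp 2) (volume : Measure (Fin 3 → ℝ)) :=
    (hpres.integrable_comp_emb hemb).2 hint
  have hInt : IntegrableOn (fun y => ∑ i, f' i y (Pi.single i 1)) (Icc a b) := by
    have : (fun y => ∑ i, f' i y (Pi.single i 1)) = G ∘ toLp 2 := funext hdiv
    rw [this]
    exact hGint.integrableOn
  have key := integral_divergence_of_hasFDerivAt_off_countable' a b hab f f' ∅ countable_empty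
    (fun i => (hfc i).continuousOn) (fun y _ i => hff' y i) hInt
  -- the face integrals vanish
  have hfaces : ∀ i : Fin 3, ∀ (c : ℝ), M ≤ |c| → ∀ z : Fin 2 → ℝ,
      f i (Fin.insertNth i c z) = 0 := by
    intro i c hc z
    exact hf0' i _ i (by simpa [Fin.insertNth_apply_same] using hc)
  have hRHS : ∑ i : Fin 3, ((∫ z in Icc (a ∘ Fin.succAbove i) (b ∘ Fin.succAbove i),
      f i (Fin.insertNth i (b i) z)) - ∫ z in Icc (a ∘ Fin.succAbove i) (b ∘ Fin.succAbove i),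
      f i (Fin.insertNth i (a i) z)) = 0 := by
    refine Finset.sum_eq_zero fun i _ => ?_
    have h1 : ∀ z : Fin 2 → ℝ, f i (Fin.insertNth i (b i) z) = 0 := fun z =>
      hfaces i (b i) (by simp [hb, abs_of_pos hM]) z
    have h2 : ∀ z : Fin 2 → ℝ, f i (Fin.insertNth i (a i) z) = 0 := fun z =>
      hfaces i (a i) (by simp [ha, abs_of_pos hM]) z
    simp [h1, h2]
  rw [hRHS] at key
  -- from the cube to the whole space, and back to `ℝ³`
  have hcube : ∫ y in Icc a b, ∑ i, f' i y (Pi.single i 1) = ∫ y, G (toLp 2 y) := by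
    simp_rw [hdiv]
    refine setIntegral_eq_integral_of_forall_compl_eq_zero fun y hy => hG0 _ ?_
    -- outside the cube some coordinate exceeds `M` in absolute value
    simp only [mem_Icc, not_and_or, Pi.le_def, ha, hb, not_forall, not_le] at hy
    rcases hy with ⟨j, hj⟩ | ⟨j, hj⟩
    · exact lt_of_lt_of_le (by rw [lt_abs]; right; linarith) (abs_apply_le_norm_toLp y j)
    · exact lt_of_lt_of_le (by rw [lt_abs]; left; linarith) (abs_apply_le_norm_toLp y j)
  rw [hcube, hpres.integral_comp hemb G] at key
  exact key

/-- **Stokes pairing `∫ ⟪B, curl Φ⟫ = ∫ ⟪curl B, Φ⟫ for a differentiable field (no boundary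
terms).** Let `B : ℝ³ → ℝ³` be differentiable everywhere and `Φ ∈ C¹(ℝ³; ℝ³)` vanish for
`‖x‖ ≥ M`. If `⟪B, curl Φ⟫ − ⟪curl B, Φ⟫` — the divergence of the everywhere differentiable,
compactly supported field `Φ × B` — is integrable, its integral vanishes. Only this divergence
is assumed integrable, not the individual partial derivatives of `B` (which for a merely
differentiable `B` need not be locally integrable): `integral_eq_zero_of_divergence_cube`.
This is the form in which the stream function enters all estimates of Lei–Zhang 2011, §§2–3
("`∫ b₂·V = ∫ (B − B̄)·∇×V`", arXiv:1011.5066 pp. 6, 9, 11), for the tree's differentiable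
stream slices. [folklore] -/
theorem integral_inner_curl_sub_inner_curl_eq_zero
    {B : EuclideanSpace ℝ (Fin 3) → EuclideanSpace ℝ (Fin 3)} (hB : Differentiable ℝ B)
    {Φ : EuclideanSpace ℝ (Fin 3) → EuclideanSpace ℝ (Fin 3)} (hΦ : ContDiff ℝ 1 Φ) {M : ℝ}
    (hM : 0 < M) (hΦM : ∀ x, M ≤ ‖x‖ → Φ x = 0)
    (hint : Integrable (fun x => ⟪B x, curl Φ x⟫ - ⟪curl B x, Φ x⟫)
      (volume : Measure (EuclideanSpace ℝ (Fin 3)))) :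
    ∫ x, (⟪B x, curl Φ x⟫ - ⟪curl B x, Φ x⟫) = 0 := by
  set G : EuclideanSpace ℝ (Fin 3) → ℝ := fun x => ⟪B x, curl Φ x⟫ - ⟪curl B x, Φ x⟫ with hG
  -- `Φ` and `fderiv Φ` vanish where `‖x‖ > M`, hence `G` does
  have hΦ_ev : ∀ x : EuclideanSpace ℝ (Fin 3), M < ‖x‖ → Φ =ᶠ[𝓝 x] fun _ => 0 := by
    intro x hx
    have ho : IsOpen {y : EuclideanSpace ℝ (Fin 3) | M < ‖y‖} :=
      isOpen_lt continuous_const continuous_norm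
    filter_upwards [ho.mem_nhds hx] with y hy
    exact hΦM y (le_of_lt hy)
  have hDΦ0 : ∀ x : EuclideanSpace ℝ (Fin 3), M < ‖x‖ → fderiv ℝ Φ x = 0 := by
    intro x hx
    rw [(hΦ_ev x hx).fderiv_eq]
    simp
  have hG0 : ∀ x : EuclideanSpace ℝ (Fin 3), M < ‖x‖ → G x = 0 := by
    intro x hx
    have hcurl0 : curl Φ x = 0 := by
      ext i
      fin_cases i <;> simp [curl, hDΦ0 x hx]
    simp [hG, hcurl0, hΦM x hx.le]
  -- transport to `Fin 3 → ℝ`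
  set L : (Fin 3 → ℝ) →L[ℝ] EuclideanSpace ℝ (Fin 3) :=
    ((PiLp.continuousLinearEquiv 2 ℝ (fun _ : Fin 3 => ℝ)).symm :
      (Fin 3 → ℝ) →L[ℝ] EuclideanSpace ℝ (Fin 3)) with hL
  have hLe : ∀ i : Fin 3, L (Pi.single i 1) = EuclideanSpace.single i 1 := fun i => rfl
  set Φc : Fin 3 → (Fin 3 → ℝ) → ℝ := fun i y => EuclideanSpace.proj (𝕜 := ℝ) i (Φ (toLp 2 y))
    with hΦc
  set Bc : Fin 3 → (Fin 3 → ℝ) → ℝ := fun i y => EuclideanSpace.proj (𝕜 := ℝ) i (B (toLp 2 y))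
    with hBc
  set DΦ : Fin 3 → (Fin 3 → ℝ) → (Fin 3 → ℝ) →L[ℝ] ℝ := fun i y =>
    (EuclideanSpace.proj i).comp ((fderiv ℝ Φ (toLp 2 y)).comp L) with hDΦ
  set DB : Fin 3 → (Fin 3 → ℝ) → (Fin 3 → ℝ) →L[ℝ] ℝ := fun i y =>
    (EuclideanSpace.proj i).comp ((fderiv ℝ B (toLp 2 y)).comp L) with hDB
  have hdΦ : ∀ i y, HasFDerivAt (Φc i) (DΦ i y) y := fun i y =>
    (EuclideanSpace.proj (𝕜 := ℝ) i).hasFDerivAt.comp y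
      (((hΦ.differentiable one_ne_zero) _).hasFDerivAt.comp y L.hasFDerivAt)
  have hdB : ∀ i y, HasFDerivAt (Bc i) (DB i y) y := fun i y =>
    (EuclideanSpace.proj (𝕜 := ℝ) i).hasFDerivAt.comp y
      ((hB _).hasFDerivAt.comp y L.hasFDerivAt)
  -- the field `Φ × B` and its derivative
  set f : Fin 3 → (Fin 3 → ℝ) → ℝ :=
    ![fun y => Φc 1 y * Bc 2 y - Φc 2 y * Bc 1 y, fun y => Φc 2 y * Bc 0 y - Φc 0 y * Bc 2 y,
      fun y => Φc 0 y * Bc 1 y - Φc 1 y * Bc 0 y] with hf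
  set f' : Fin 3 → (Fin 3 → ℝ) → (Fin 3 → ℝ) →L[ℝ] ℝ :=
    ![fun y => (Φc 1 y • DB 2 y + Bc 2 y • DΦ 1 y) - (Φc 2 y • DB 1 y + Bc 1 y • DΦ 2 y),
      fun y => (Φc 2 y • DB 0 y + Bc 0 y • DΦ 2 y) - (Φc 0 y • DB 2 y + Bc 2 y • DΦ 0 y),
      fun y => (Φc 0 y • DB 1 y + Bc 1 y • DΦ 0 y) - (Φc 1 y • DB 0 y + Bc 0 y • DΦ 1 y)]
    with hf'
  have hff' : ∀ y i, HasFDerivAt (f i) (f' i y) y := by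
    intro y i
    fin_cases i
    · exact ((hdΦ 1 y).mul (hdB 2 y)).sub ((hdΦ 2 y).mul (hdB 1 y))
    · exact ((hdΦ 2 y).mul (hdB 0 y)).sub ((hdΦ 0 y).mul (hdB 2 y))
    · exact ((hdΦ 0 y).mul (hdB 1 y)).sub ((hdΦ 1 y).mul (hdB 0 y))
  -- continuity of the components
  have hΦcc : ∀ i, Continuous (Φc i) := fun i =>
    (EuclideanSpace.proj i).continuous.comp (hΦ.continuous.comp (PiLp.continuous_toLp 2 _))
  have hBcc : ∀ i, Continuous (Bc i) := fun i =>
    (EuclideanSpace.proj i).continuous.comp (hB.continuous.comp (PiLp.continuous_toLp 2 _))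
  have hfc : ∀ i, Continuous (f i) := by
    intro i
    fin_cases i
    · exact ((hΦcc 1).mul (hBcc 2)).sub ((hΦcc 2).mul (hBcc 1))
    · exact ((hΦcc 2).mul (hBcc 0)).sub ((hΦcc 0).mul (hBcc 2))
    · exact ((hΦcc 0).mul (hBcc 1)).sub ((hΦcc 1).mul (hBcc 0))
  -- the divergence is `G ∘ toLp`: `div (Φ × B) = ⟪B, curl Φ⟫ - ⟪Φ, curl B⟫`
  have hdiv : ∀ y, ∑ i, f' i y (Pi.single i 1) = G (toLp 2 y) := by
    intro y
    simp only [hf', hG, Fin.sum_univ_three, Matrix.cons_val_zero, Matrix.cons_val_one,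
      Matrix.cons_val_two, Matrix.tail_cons, Matrix.head_cons, sub_apply, add_apply, smul_apply,
      smul_eq_mul, hDB, hDΦ, ContinuousLinearMap.comp_apply, hLe, EuclideanSpace.coe_proj, hBc,
      hΦc, curl, PiLp.inner_apply, RCLike.inner_apply, conj_trivial]
    ring
  -- `f i` vanishes where `‖toLp 2 y‖ ≥ M`
  have hf0 : ∀ i (y : Fin 3 → ℝ), M ≤ ‖(toLp 2 y : EuclideanSpace ℝ (Fin 3))‖ → f i y = 0 := by
    intro i y hy
    have hΦy : ∀ j, Φc j y = 0 := fun j => by simp [hΦc, hΦM _ hy]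
    fin_cases i <;> simp [hf, hΦy]
  exact integral_eq_zero_of_divergence_cube hfc hff' hM hf0 hdiv hG0 hint

/-- **Stokes pairing against `φ e_z` (no boundary terms).** Let `B : ℝ³ → ℝ³` be
differentiable everywhere and `φ ∈ C¹(ℝ³)` vanish for `‖x‖ ≥ M`. If the function
`(∂₁φ) B₀ − (∂₀φ) B₁ − φ (curl B)₂` — the divergence of the everywhere differentiable,
compactly supported field `φ e_z × B = (−φ B₁, φ B₀, 0)` — is integrable, then its integral
vanishes. Only the divergence is assumed integrable, not the individual partial derivatives of
`B` (`integral_eq_zero_of_divergence_cube`). [folklore] -/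
theorem integral_rotPairing_sub_mul_curl_eq_zero
    {B : EuclideanSpace ℝ (Fin 3) → EuclideanSpace ℝ (Fin 3)} (hB : Differentiable ℝ B)
    {φ : EuclideanSpace ℝ (Fin 3) → ℝ} (hφ : ContDiff ℝ 1 φ) {M : ℝ} (hM : 0 < M)
    (hφM : ∀ x, M ≤ ‖x‖ → φ x = 0)
    (hint : Integrable (fun x => fderiv ℝ φ x (EuclideanSpace.single 1 1) * B x 0 -
      fderiv ℝ φ x (EuclideanSpace.single 0 1) * B x 1 - φ x * curl B x 2)
      (volume : Measure (EuclideanSpace ℝ (Fin 3)))) :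
    ∫ x, (fderiv ℝ φ x (EuclideanSpace.single 1 1) * B x 0 -
      fderiv ℝ φ x (EuclideanSpace.single 0 1) * B x 1 - φ x * curl B x 2) = 0 := by
  -- the integrand, as a function on `ℝ³`
  set G : EuclideanSpace ℝ (Fin 3) → ℝ := fun x =>
    fderiv ℝ φ x (EuclideanSpace.single 1 1) * B x 0 -
      fderiv ℝ φ x (EuclideanSpace.single 0 1) * B x 1 - φ x * curl B x 2 with hG
  -- `φ` and `fderiv φ` vanish where `‖x‖ > M`, hence `G` does
  have hφ_ev : ∀ x : EuclideanSpace ℝ (Fin 3), M < ‖x‖ → φ =ᶠ[𝓝 x] fun _ => 0 := by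
    intro x hx
    have ho : IsOpen {y : EuclideanSpace ℝ (Fin 3) | M < ‖y‖} :=
      isOpen_lt continuous_const continuous_norm
    filter_upwards [ho.mem_nhds hx] with y hy
    exact hφM y (le_of_lt hy)
  have hDφ0 : ∀ x : EuclideanSpace ℝ (Fin 3), M < ‖x‖ → fderiv ℝ φ x = 0 := by
    intro x hx
    rw [(hφ_ev x hx).fderiv_eq]
    simp
  have hG0 : ∀ x : EuclideanSpace ℝ (Fin 3), M < ‖x‖ → G x = 0 := by
    intro x hx
    simp [hG, hDφ0 x hx, hφM x hx.le]
  -- transport to `Fin 3 → ℝ`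
  set L : (Fin 3 → ℝ) →L[ℝ] EuclideanSpace ℝ (Fin 3) :=
    ((PiLp.continuousLinearEquiv 2 ℝ (fun _ : Fin 3 => ℝ)).symm :
      (Fin 3 → ℝ) →L[ℝ] EuclideanSpace ℝ (Fin 3)) with hL
  have hLe : ∀ i : Fin 3, L (Pi.single i 1) = EuclideanSpace.single i 1 := fun i => rfl
  set φ' : (Fin 3 → ℝ) → ℝ := fun y => φ (toLp 2 y) with hφ'
  set Bc : Fin 3 → (Fin 3 → ℝ) → ℝ := fun i y => EuclideanSpace.proj (𝕜 := ℝ) i (B (toLp 2 y))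
    with hBc
  set Dφ : (Fin 3 → ℝ) → (Fin 3 → ℝ) →L[ℝ] ℝ := fun y => (fderiv ℝ φ (toLp 2 y)).comp L with hDφ
  set DB : Fin 3 → (Fin 3 → ℝ) → (Fin 3 → ℝ) →L[ℝ] ℝ := fun i y =>
    (EuclideanSpace.proj i).comp ((fderiv ℝ B (toLp 2 y)).comp L) with hDB
  have hdφ' : ∀ y, HasFDerivAt φ' (Dφ y) y := fun y =>
    ((hφ.differentiable one_ne_zero) _).hasFDerivAt.comp y L.hasFDerivAt
  have hdB : ∀ i y, HasFDerivAt (Bc i) (DB i y) y := fun i y =>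
    (EuclideanSpace.proj (𝕜 := ℝ) i).hasFDerivAt.comp y
      ((hB _).hasFDerivAt.comp y L.hasFDerivAt)
  -- the field `φ e_z × B` and its derivative
  set f : Fin 3 → (Fin 3 → ℝ) → ℝ :=
    ![fun y => -(φ' y * Bc 1 y), fun y => φ' y * Bc 0 y, fun _ => 0] with hf
  set f' : Fin 3 → (Fin 3 → ℝ) → (Fin 3 → ℝ) →L[ℝ] ℝ :=
    ![fun y => -(φ' y • DB 1 y + Bc 1 y • Dφ y), fun y => φ' y • DB 0 y + Bc 0 y • Dφ y,
      fun _ => 0] with hf'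
  have hff' : ∀ y i, HasFDerivAt (f i) (f' i y) y := by
    intro y i
    fin_cases i
    · exact ((hdφ' y).mul (hdB 1 y)).neg
    · exact (hdφ' y).mul (hdB 0 y)
    · exact hasFDerivAt_const _ _
  -- continuity of the components
  have hφc : Continuous φ' := hφ.continuous.comp (PiLp.continuous_toLp 2 _)
  have hBcc : ∀ i, Continuous (Bc i) := fun i =>
    (EuclideanSpace.proj i).continuous.comp (hB.continuous.comp (PiLp.continuous_toLp 2 _))
  have hfc : ∀ i, Continuous (f i) := by
    intro i
    fin_cases i
    · exact (hφc.mul (hBcc 1)).neg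
    · exact hφc.mul (hBcc 0)
    · exact continuous_const
  -- the divergence is `G ∘ toLp`
  have hdiv : ∀ y, ∑ i, f' i y (Pi.single i 1) = G (toLp 2 y) := by
    intro y
    simp only [hf', hG, Fin.sum_univ_three, Matrix.cons_val_zero, Matrix.cons_val_one,
      Matrix.cons_val_two, Matrix.tail_cons, Matrix.head_cons, neg_apply, add_apply, smul_apply,
      smul_eq_mul, zero_apply, add_zero, hDB, hDφ, ContinuousLinearMap.comp_apply, hLe,
      EuclideanSpace.coe_proj, hBc, hφ', curl_apply_two]
    ring
  -- `f i` vanishes where `‖toLp 2 y‖ ≥ M`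
  have hf0 : ∀ i (y : Fin 3 → ℝ), M ≤ ‖(toLp 2 y : EuclideanSpace ℝ (Fin 3))‖ → f i y = 0 := by
    intro i y hy
    have hφy : φ' y = 0 := hφM _ hy
    fin_cases i <;> simp [hf, hφy]
  exact integral_eq_zero_of_divergence_cube hfc hff' hM hf0 hdiv hG0 hint

end Stokes

/-! ### From the `BMO` seminorm of a field to `L¹` oscillation bounds of its components -/

section BMO

/-- A component of a continuous field is continuous. [folklore] -/
theorem continuous_apply_of_continuous {B : EuclideanSpace ℝ (Fin 3) → EuclideanSpace ℝ (Fin 3)}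
    (hB : Continuous B) (i : Fin 3) :
    Continuous fun x => B x i :=
  (EuclideanSpace.proj i).continuous.comp hB

/-- The `BMO` seminorm of a component is at most the `BMO` seminorm of the field
(`⟪B, eᵢ⟫ = Bᵢ`, `‖eᵢ‖ = 1`). [folklore] -/
theorem eBMOSeminorm_apply_le_eBMOSeminormVec
    (B : EuclideanSpace ℝ (Fin 3) → EuclideanSpace ℝ (Fin 3)) (i : Fin 3) :
    eBMOSeminorm (fun x => B x i) ≤ eBMOSeminormVec B := by
  have h : (fun x => B x i) = fun x => ⟪B x, EuclideanSpace.single i (1 : ℝ)⟫ := by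
    funext x
    rw [EuclideanSpace.inner_single_right]
    simp
  rw [h]
  exact le_iSup₂_of_le (EuclideanSpace.single i (1 : ℝ)) (by simp) le_rfl

/-- **`L¹` oscillation of a component over a ball.** For a continuous field `B` with
`‖B‖_BMO ≤ C` (the tree's `eBMOSeminormVec`), `∫_{B(x₀,r)} |Bᵢ − (Bᵢ)_{B(x₀,r)}| ≤ C |B(x₀,r)|`
(the defining inequality of `BMO`, John–Nirenberg 1961 (1), in real form; continuity makes the
Bochner ball average the true average). [folklore] -/
theorem setIntegral_abs_apply_sub_average_le
    {B : EuclideanSpace ℝ (Fin 3) → EuclideanSpace ℝ (Fin 3)} (hB : Continuous B) {C : ℝ≥0}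
    (hBMO : eBMOSeminormVec B ≤ C) (i : Fin 3) (x₀ : EuclideanSpace ℝ (Fin 3)) {r : ℝ}
    (hr : 0 < r) :
    ∫ x in ball x₀ r, |B x i - ⨍ z in ball x₀ r, B z i| ≤ C * volume.real (ball x₀ r) := by
  set f : EuclideanSpace ℝ (Fin 3) → ℝ := fun x => B x i with hf
  have hfc : Continuous f := continuous_apply_of_continuous hB i
  have hfBMO : eBMOSeminorm f ≤ C := (eBMOSeminorm_apply_le_eBMOSeminormVec B i).trans hBMO
  have h1 := laverage_oscillation_le_eBMOSeminorm f volume x₀ hr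
  rw [setLAverage_eq] at h1
  have hμ0 : volume (ball x₀ r) ≠ 0 := (measure_ball_pos volume x₀ hr).ne'
  have hμt : volume (ball x₀ r) ≠ ∞ := measure_ball_lt_top.ne
  have h2 : ∫⁻ y in ball x₀ r, ‖f y - ⨍ z in ball x₀ r, f z‖ₑ ≤ C * volume (ball x₀ r) := by
    have := (ENNReal.div_le_iff hμ0 hμt).1 (h1.trans hfBMO)
    simpa [mul_comm] using this
  -- the oscillation is continuous, hence integrable on the ball
  have hgc : Continuous fun y => f y - ⨍ z in ball x₀ r, f z := hfc.sub continuous_const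
  have hgi : IntegrableOn (fun y => f y - ⨍ z in ball x₀ r, f z) (ball x₀ r) :=
    (hgc.continuousOn.integrableOn_compact (isCompact_closedBall x₀ r)).mono_set
      ball_subset_closedBall
  have h3 : ∫ y in ball x₀ r, |f y - ⨍ z in ball x₀ r, f z| =
      (∫⁻ y in ball x₀ r, ‖f y - ⨍ z in ball x₀ r, f z‖ₑ).toReal := by
    rw [← integral_norm_eq_lintegral_enorm hgi.aestronglyMeasurable]
    simp [Real.norm_eq_abs]
  rw [h3]
  have h4 : (C * volume (ball x₀ r)).toReal = C * volume.real (ball x₀ r) := by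
    rw [ENNReal.toReal_mul, Measure.real]
    simp
  rw [← h4]
  exact ENNReal.toReal_mono (ENNReal.mul_ne_top (by simp) hμt) h2

/-- Volume of a ball of `ℝ³` in terms of the unit ball: `|B(x, r)| = r³ |B(0, 1)|`. [folklore] -/
theorem volume_real_ball_eq (x : EuclideanSpace ℝ (Fin 3)) {r : ℝ} (hr : 0 < r) :
    volume.real (ball x r) = r ^ 3 * volume.real (ball (0 : EuclideanSpace ℝ (Fin 3)) 1) := by
  simp only [Measure.real]
  rw [Measure.addHaar_ball_of_pos volume x hr, finrank_euclideanSpace_fin, ENNReal.toReal_mul,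
    ENNReal.toReal_ofReal (pow_nonneg hr.le 3)]

end BMO

/-! ### Step (3): a `BMO` field whose curl is an a.e. constant axial vector has zero curl -/

section Step3

/-- **A differentiable field with finite `BMO` seminorm whose curl has a.e.-constant axial
component `l` has `l = 0`** (the content of the last step of the printed proof of Lei–Zhang's
Theorem 1.2, arXiv:1011.5066 p. 12 — "the stream function `B`, being [BMO and harmonic, hence]
a bounded function, is constant. Therefore `v = ∇ × B = 0`" — in the tree form, where `B` is
only differentiable and not divergence free; see the module docstring for the Stokes-pairing
argument `|l| R ≤ 16 C₀ ‖B‖_BMO` used instead).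
[cite: LeiZhang2011, proof of Thm. 1.2, §4 (arXiv p. 12)] -/
theorem eq_zero_of_ae_curl_apply_two_eq_of_eBMOSeminormVec_le
    {B : EuclideanSpace ℝ (Fin 3) → EuclideanSpace ℝ (Fin 3)}
    (hB : Differentiable ℝ B) {C : ℝ≥0} (hBMO : eBMOSeminormVec B ≤ C) {l : ℝ}
    (hcurl : ∀ᵐ x ∂(volume : Measure (EuclideanSpace ℝ (Fin 3))), curl B x 2 = l) : l = 0 := by
  obtain ⟨C₀, hC₀, hDφ⟩ := exists_norm_fderiv_ballCutoff_le
  set V₁ : ℝ := volume.real (ball (0 : EuclideanSpace ℝ (Fin 3)) 1) with hV₁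
  have hV₁pos : 0 < V₁ := by
    rw [hV₁, Measure.real, ENNReal.toReal_pos_iff]
    exact ⟨measure_ball_pos volume (0 : EuclideanSpace ℝ (Fin 3)) one_pos, measure_ball_lt_top⟩
  -- the estimate at scale `R`
  have main : ∀ R : ℝ, 0 < R → |l| * ((2 * R) ^ 3 * V₁) ≤
      C₀ / R * (C * ((4 * R) ^ 3 * V₁) + C * ((4 * R) ^ 3 * V₁)) := by
    intro R hR
    set φ : EuclideanSpace ℝ (Fin 3) → ℝ := ballCutoff (0 : EuclideanSpace ℝ (Fin 3)) R with hφdef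
    have hφC : ContDiff ℝ 1 φ := contDiff_ballCutoff 0 R
    have hφM : ∀ x : EuclideanSpace ℝ (Fin 3), 3 * R ≤ ‖x‖ → φ x = 0 := fun x hx =>
      ballCutoff_eq_zero hR (by simpa using hx)
    -- averages over `B(0, 4R)` and the shifted field
    set a₀ : ℝ := ⨍ z in ball (0 : EuclideanSpace ℝ (Fin 3)) (4 * R), B z 0 with ha₀
    set a₁ : ℝ := ⨍ z in ball (0 : EuclideanSpace ℝ (Fin 3)) (4 * R), B z 1 with ha₁
    set a : EuclideanSpace ℝ (Fin 3) := EuclideanSpace.single 0 a₀ + EuclideanSpace.single 1 a₁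
      with ha
    have ha0 : a 0 = a₀ := by simp [ha]
    have ha1 : a 1 = a₁ := by simp [ha]
    set B' : EuclideanSpace ℝ (Fin 3) → EuclideanSpace ℝ (Fin 3) := fun x => B x - a with hB'
    have hB'd : Differentiable ℝ B' := fun x => (hB x).sub_const a
    have hcurl' : ∀ x, curl B' x = curl B x := by
      intro x
      simp only [curl, hB', fderiv_sub_const]
    have hB'0 : ∀ x, B' x 0 = B x 0 - a₀ := fun x => by simp [hB', ha0]
    have hB'1 : ∀ x, B' x 1 = B x 1 - a₁ := fun x => by simp [hB', ha1]
    -- the two parts of the integrand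
    set p₁ : EuclideanSpace ℝ (Fin 3) → ℝ := fun x =>
      fderiv ℝ φ x (EuclideanSpace.single 1 1) * B' x 0 -
        fderiv ℝ φ x (EuclideanSpace.single 0 1) * B' x 1 with hp₁
    set p₂ : EuclideanSpace ℝ (Fin 3) → ℝ := fun x => φ x * curl B' x 2 with hp₂
    -- `fderiv φ` vanishes off `B̄(0, 3R)`
    have hDφ0 : ∀ x : EuclideanSpace ℝ (Fin 3),
        x ∉ closedBall (0 : EuclideanSpace ℝ (Fin 3)) (3 * R) → fderiv ℝ φ x = 0 := by
      intro x hx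
      rw [(ballCutoff_eventuallyEq_zero hR hx).fderiv_eq]
      simp
    have hp₁0 : ∀ x : EuclideanSpace ℝ (Fin 3),
        x ∉ closedBall (0 : EuclideanSpace ℝ (Fin 3)) (3 * R) → p₁ x = 0 := by
      intro x hx
      simp [hp₁, hDφ0 x hx]
    -- integrability
    have hφi : Integrable φ (volume : Measure (EuclideanSpace ℝ (Fin 3))) :=
      hφC.continuous.integrable_of_hasCompactSupport (hasCompactSupport_ballCutoff hR)
    have hp₁c : Continuous p₁ := by
      have hD : ∀ v : EuclideanSpace ℝ (Fin 3), Continuous fun x => fderiv ℝ φ x v := fun v =>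
        (hφC.continuous_fderiv one_ne_zero).clm_apply continuous_const
      exact ((hD _).mul (continuous_apply_of_continuous hB'd.continuous 0)).sub
        ((hD _).mul (continuous_apply_of_continuous hB'd.continuous 1))
    have hp₁i : Integrable p₁ (volume : Measure (EuclideanSpace ℝ (Fin 3))) :=
      hp₁c.integrable_of_hasCompactSupport
        (HasCompactSupport.intro (isCompact_closedBall (0 : EuclideanSpace ℝ (Fin 3)) (3 * R)) hp₁0)
    have hp₂ae : p₂ =ᵐ[volume] fun x => φ x * l := by
      filter_upwards [hcurl] with x hx
      simp [hp₂, hcurl' x, hx]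
    have hp₂i : Integrable p₂ (volume : Measure (EuclideanSpace ℝ (Fin 3))) :=
      (hφi.mul_const l).congr hp₂ae.symm
    -- the Stokes pairing: `∫ p₁ = ∫ p₂ = l ∫ φ`
    have hStokes := integral_rotPairing_sub_mul_curl_eq_zero hB'd hφC (by positivity) hφM
      (hp₁i.sub hp₂i)
    have hI : ∫ x, p₁ x = l * ∫ x, φ x := by
      have h1 : ∫ x, (p₁ x - p₂ x) = 0 := hStokes
      rw [integral_sub hp₁i hp₂i, sub_eq_zero] at h1
      rw [h1, integral_congr_ae hp₂ae, integral_mul_const, mul_comm]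
    -- lower bound: `∫ φ ≥ |B(0, 2R)|`
    have hlow : (2 * R) ^ 3 * V₁ ≤ ∫ x, φ x := by
      have h1 : ∫ x in ball (0 : EuclideanSpace ℝ (Fin 3)) (2 * R), φ x = (2 * R) ^ 3 * V₁ := by
        rw [setIntegral_congr_fun measurableSet_ball (g := fun _ => (1 : ℝ))]
        · rw [setIntegral_const, smul_eq_mul, mul_one, volume_real_ball_eq 0 (by positivity)]
        · intro x hx
          refine ballCutoff_eq_one hR ?_
          rw [sub_zero]
          exact (mem_ball_zero_iff.1 hx).le
      rw [← h1]
      exact setIntegral_le_integral hφi (Eventually.of_forall fun x => ballCutoff_nonneg 0 R x)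
    -- upper bound: `|∫ p₁| ≤ (C₀/R) (∫_{B(0,4R)} |B₀ − a₀| + ∫_{B(0,4R)} |B₁ − a₁|)`
    set g : EuclideanSpace ℝ (Fin 3) → ℝ := indicator (ball (0 : EuclideanSpace ℝ (Fin 3)) (4 * R))
      (fun x => C₀ / R * (|B x 0 - a₀| + |B x 1 - a₁|)) with hg
    have hgi0 : IntegrableOn (fun x => C₀ / R * (|B x 0 - a₀| + |B x 1 - a₁|))
        (ball (0 : EuclideanSpace ℝ (Fin 3)) (4 * R)) := by
      have hc : Continuous fun x => C₀ / R * (|B x 0 - a₀| + |B x 1 - a₁|) :=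
        continuous_const.mul
          (((continuous_apply_of_continuous hB.continuous 0).sub continuous_const).abs.add
            ((continuous_apply_of_continuous hB.continuous 1).sub continuous_const).abs)
      exact (hc.continuousOn.integrableOn_compact (isCompact_closedBall 0 (4 * R))).mono_set
        ball_subset_closedBall
    have hgi : Integrable g (volume : Measure (EuclideanSpace ℝ (Fin 3))) :=
      hgi0.integrable_indicator measurableSet_ball
    have hbound : ∀ x, |p₁ x| ≤ g x := by
      intro x
      by_cases hx : x ∈ closedBall (0 : EuclideanSpace ℝ (Fin 3)) (3 * R)
      · have hx4 : x ∈ ball (0 : EuclideanSpace ℝ (Fin 3)) (4 * R) := by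
          rw [mem_closedBall, dist_zero_right] at hx
          rw [mem_ball_zero_iff]
          linarith
        rw [hg, indicator_of_mem hx4]
        have hD : ∀ i : Fin 3, |fderiv ℝ φ x (EuclideanSpace.single i 1)| ≤ C₀ / R := by
          intro i
          calc |fderiv ℝ φ x (EuclideanSpace.single i 1)|
              = ‖fderiv ℝ φ x (EuclideanSpace.single i 1)‖ := (Real.norm_eq_abs _).symm
            _ ≤ ‖fderiv ℝ φ x‖ * ‖(EuclideanSpace.single i (1 : ℝ) : EuclideanSpace ℝ (Fin 3))‖ :=
                ContinuousLinearMap.le_opNorm _ _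
            _ ≤ C₀ / R * 1 := by
                refine mul_le_mul (hDφ 0 R hR x) (by simp) (norm_nonneg _) ?_
                exact div_nonneg hC₀ hR.le
            _ = C₀ / R := mul_one _
        have hnn0 : 0 ≤ |B x 0 - a₀| := abs_nonneg _
        have hnn1 : 0 ≤ |B x 1 - a₁| := abs_nonneg _
        calc |p₁ x| ≤ |fderiv ℝ φ x (EuclideanSpace.single 1 1) * B' x 0| +
              |fderiv ℝ φ x (EuclideanSpace.single 0 1) * B' x 1| := abs_sub _ _
          _ = |fderiv ℝ φ x (EuclideanSpace.single 1 1)| * |B x 0 - a₀| +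
              |fderiv ℝ φ x (EuclideanSpace.single 0 1)| * |B x 1 - a₁| := by
                rw [abs_mul, abs_mul, hB'0, hB'1]
          _ ≤ C₀ / R * |B x 0 - a₀| + C₀ / R * |B x 1 - a₁| := by
                gcongr
                · exact hD 1
                · exact hD 0
          _ = C₀ / R * (|B x 0 - a₀| + |B x 1 - a₁|) := by ring
      · rw [hp₁0 x hx, abs_zero, hg]
        refine indicator_nonneg (fun y _ => ?_) x
        exact mul_nonneg (div_nonneg hC₀ hR.le) (add_nonneg (abs_nonneg _) (abs_nonneg _))
    have hup : |∫ x, p₁ x| ≤ C₀ / R * (C * ((4 * R) ^ 3 * V₁) + C * ((4 * R) ^ 3 * V₁)) := by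
      calc |∫ x, p₁ x| ≤ ∫ x, |p₁ x| := abs_integral_le_integral_abs
        _ ≤ ∫ x, g x := integral_mono hp₁i.abs hgi hbound
        _ = C₀ / R * ((∫ x in ball (0 : EuclideanSpace ℝ (Fin 3)) (4 * R), |B x 0 - a₀|) +
              ∫ x in ball (0 : EuclideanSpace ℝ (Fin 3)) (4 * R), |B x 1 - a₁|) := by
            rw [hg, integral_indicator measurableSet_ball, integral_const_mul,
              integral_add]
            · exact ((((continuous_apply_of_continuous hB.continuous 0).sub
                continuous_const).abs).continuousOn.integrableOn_compact
                  (isCompact_closedBall 0 (4 * R))).mono_set ball_subset_closedBall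
            · exact ((((continuous_apply_of_continuous hB.continuous 1).sub
                continuous_const).abs).continuousOn.integrableOn_compact
                  (isCompact_closedBall 0 (4 * R))).mono_set ball_subset_closedBall
        _ ≤ C₀ / R * (C * volume.real (ball (0 : EuclideanSpace ℝ (Fin 3)) (4 * R)) +
              C * volume.real (ball (0 : EuclideanSpace ℝ (Fin 3)) (4 * R))) :=
            mul_le_mul_of_nonneg_left (add_le_add
              (setIntegral_abs_apply_sub_average_le hB.continuous hBMO 0 0 (by positivity))
              (setIntegral_abs_apply_sub_average_le hB.continuous hBMO 1 0 (by positivity)))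
              (div_nonneg hC₀ hR.le)
        _ = C₀ / R * (C * ((4 * R) ^ 3 * V₁) + C * ((4 * R) ^ 3 * V₁)) := by
            rw [volume_real_ball_eq 0 (by positivity)]
    -- combine
    calc |l| * ((2 * R) ^ 3 * V₁) ≤ |l| * ∫ x, φ x :=
          mul_le_mul_of_nonneg_left hlow (abs_nonneg l)
      _ = |∫ x, p₁ x| := by rw [hI, abs_mul, abs_of_nonneg (le_trans (by positivity) hlow)]
      _ ≤ _ := hup
  -- conclude: `|l| R ≤ 16 C₀ C` for all `R > 0`
  by_contra hl
  have hlpos : 0 < |l| := abs_pos.2 hl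
  have hCC : 0 ≤ C₀ * C := mul_nonneg hC₀ C.2
  set R : ℝ := 16 * C₀ * C / |l| + 1 with hR
  have hRpos : 0 < R := by
    have : 0 ≤ 16 * C₀ * C / |l| := div_nonneg (by nlinarith) hlpos.le
    linarith
  have h := main R hRpos
  -- `|l| * 8 R³ V₁ ≤ (C₀/R) * 2 C * 64 R³ V₁`, i.e. `|l| * R ≤ 16 C₀ C`
  have h2 : |l| * R ≤ 16 * C₀ * C := by
    have hR3 : 0 < R ^ 2 * V₁ := by positivity
    have key : |l| * R * (8 * (R ^ 2 * V₁)) ≤ 16 * C₀ * C * (8 * (R ^ 2 * V₁)) := by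
      have e1 : |l| * ((2 * R) ^ 3 * V₁) = |l| * R * (8 * (R ^ 2 * V₁)) := by ring
      have e2 : C₀ / R * (C * ((4 * R) ^ 3 * V₁) + C * ((4 * R) ^ 3 * V₁)) =
          16 * C₀ * C * (8 * (R ^ 2 * V₁)) := by
        field_simp
        ring
      rw [← e1, ← e2]
      exact h
    exact le_of_mul_le_mul_right key (by positivity)
  have h3 : |l| * R = 16 * C₀ * C + |l| := by
    rw [hR]
    field_simp
  rw [h3] at h2
  linarith

end Step3

/-! ### The drift term through the stream function (Lei–Zhang 2011, §2, the `b₂` term) -/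

section StreamDrift

/-- **`curl (h ∇ψ) = ∇h × ∇ψ`** at a point of differentiability of `h`, for `ψ ∈ C²`
(`curl (φ f) = φ curl f + ∇φ × f`, the tree's `curl_smul`, and `curl ∇ψ = 0`,
`curl_gradient_eq_zero_holds`; `∇ψ ∈ C¹` is the tree's `contDiff_one_gradient`). [folklore] -/
theorem curl_smul_gradient {h ψ : EuclideanSpace ℝ (Fin 3) → ℝ} {x : EuclideanSpace ℝ (Fin 3)}
    (hh : DifferentiableAt ℝ h x) (hψ : ContDiff ℝ 2 ψ) :
    curl (fun y => h y • gradient ψ y) x = cross (gradient h x) (gradient ψ x) := by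
  have hgψ : DifferentiableAt ℝ (gradient ψ) x :=
    ((contDiff_one_gradient hψ).differentiable one_ne_zero) x
  rw [curl_smul hh hgψ, curl_gradient_eq_zero_holds ψ hψ x, smul_zero, zero_add,
    fderiv_eq_innerSL_gradient, curlCLM_smulRight_innerSL]

/-- `‖v × w‖ ≤ ‖v‖ ‖w‖` (from `‖v × w‖ = ‖v‖ ‖w‖ sin ∠(v, w)`, the tree's `norm_cross`).
[folklore] -/
theorem norm_cross_le_norm_mul_norm (v w : EuclideanSpace ℝ (Fin 3)) :
    ‖cross v w‖ ≤ ‖v‖ * ‖w‖ := by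
  rw [norm_cross]
  exact mul_le_of_le_one_right (mul_nonneg (norm_nonneg _) (norm_nonneg _))
    (Real.sin_le_one _)

/-- **The pointwise bound for the stream-function form of the drift term**:
`|⟪B − c, ∇h × ∇ψ⟫| ≤ ‖B − c‖ ‖∇h‖ ‖∇ψ‖` (Cauchy–Schwarz and `‖v × w‖ ≤ ‖v‖‖w‖`); in Lei–Zhang
§2 this is the step "`≲ ∫ |B − B̄| |f| |ψ∇f| |∇ψ|`" before Hölder and John–Nirenberg. [folklore] -/
theorem abs_inner_sub_cross_gradient_le (B : EuclideanSpace ℝ (Fin 3) → EuclideanSpace ℝ (Fin 3))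
    (c : EuclideanSpace ℝ (Fin 3)) (h ψ : EuclideanSpace ℝ (Fin 3) → ℝ) (x : EuclideanSpace ℝ (Fin 3)) :
    |⟪B x - c, cross (gradient h x) (gradient ψ x)⟫| ≤
      ‖B x - c‖ * (‖gradient h x‖ * ‖gradient ψ x‖) :=
  (abs_real_inner_le_norm _ _).trans
    (mul_le_mul_of_nonneg_left (norm_cross_le_norm_mul_norm _ _) (norm_nonneg _))

/-- **The drift term through the stream function** (Lei–Zhang 2011, §2, treatment of `b₂ = ∇ × B`,
arXiv:1011.5066 p. 6: "`−½∬ (b₂·∇f²)ψ_R² = ∬ (B − B̄(t))·∇×(…)`", and §3 p. 9, Lemma 3.4 p. 11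
likewise). Let `B` be differentiable with `curl B = V` a.e., `V` locally integrable (a slice of
the velocity), `h ∈ C¹` (there: `f²`, `Φ^p`, `(Ψ − Ψ̄)ζ`-type factors) and `ψ ∈ C²_c` (the
cut-off). Then for every constant `c` (there: the ball average `B̄`),
`∫ h ⟪V, ∇ψ⟫ = ∫ ⟪B − c, ∇h × ∇ψ⟫`:
the field `Φ = h ∇ψ ∈ C¹_c` has `curl Φ = ∇h × ∇ψ`, and the Stokes pairing for the merely
differentiable `B − c` (`integral_inner_curl_sub_inner_curl_eq_zero`) moves the curl across. With
`abs_inner_sub_cross_gradient_le`, Hölder and the John–Nirenberg `L^p` bound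
(`exists_eLpNorm_sub_average_le`) this gives the printed `b₂` estimates. [cite: LeiZhang2011, §2 (arXiv:1011.5066 p. 6), treatment of b₂] -/
theorem integral_mul_inner_gradient_eq_integral_inner_sub_cross
    {B : EuclideanSpace ℝ (Fin 3) → EuclideanSpace ℝ (Fin 3)} (hB : Differentiable ℝ B)
    {V : EuclideanSpace ℝ (Fin 3) → EuclideanSpace ℝ (Fin 3)} (hV : curl B =ᵐ[volume] V)
    (hVi : LocallyIntegrable V volume)
    {h : EuclideanSpace ℝ (Fin 3) → ℝ} (hh : ContDiff ℝ 1 h) {ψ : EuclideanSpace ℝ (Fin 3) → ℝ}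
    (hψ : ContDiff ℝ 2 ψ) (hψc : HasCompactSupport ψ) (c : EuclideanSpace ℝ (Fin 3)) :
    ∫ x, h x * ⟪V x, gradient ψ x⟫ = ∫ x, ⟪B x - c, cross (gradient h x) (gradient ψ x)⟫ := by
  -- the test field `Φ = h ∇ψ ∈ C¹_c` and its curl
  set Φ : EuclideanSpace ℝ (Fin 3) → EuclideanSpace ℝ (Fin 3) := fun y => h y • gradient ψ y with hΦ
  have hΦ1 : ContDiff ℝ 1 Φ := hh.smul (contDiff_one_gradient hψ)
  have hcurlΦ : ∀ x, curl Φ x = cross (gradient h x) (gradient ψ x) := fun x =>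
    curl_smul_gradient ((hh.differentiable one_ne_zero) x) hψ
  -- a ball containing the support of `ψ`
  obtain ⟨M₀, hM₀⟩ := hψc.isCompact.isBounded.subset_closedBall (0 : EuclideanSpace ℝ (Fin 3))
  set M : ℝ := max M₀ 0 + 1 with hM
  have hMpos : 0 < M := by rw [hM]; positivity
  have hout : ∀ x : EuclideanSpace ℝ (Fin 3), M ≤ ‖x‖ → x ∉ tsupport ψ := by
    intro x hx hxs
    have := hM₀ hxs
    rw [mem_closedBall, dist_zero_right] at this
    have : M₀ ≤ max M₀ 0 := le_max_left _ _
    linarith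
  have hgrad0 : ∀ x : EuclideanSpace ℝ (Fin 3), M ≤ ‖x‖ → gradient ψ x = 0 := fun x hx =>
    gradient_eq_zero_of_notMem_tsupport (hout x hx)
  have hΦM : ∀ x, M ≤ ‖x‖ → Φ x = 0 := fun x hx => by simp [hΦ, hgrad0 x hx]
  -- the shifted field
  set B' : EuclideanSpace ℝ (Fin 3) → EuclideanSpace ℝ (Fin 3) := fun x => B x - c with hB'
  have hB'd : Differentiable ℝ B' := fun x => (hB x).sub_const c
  have hcurlB' : curl B' = curl B := curl_sub_const_eq B c
  -- integrability of the two pairings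
  have hgradh : Continuous (gradient h) := continuous_gradient_of_contDiff hh
  have hgradψ : Continuous (gradient ψ) := continuous_gradient_of_contDiff (hψ.of_le one_le_two)
  have hcrossc : Continuous fun x => cross (gradient h x) (gradient ψ x) := by
    have : (fun x => cross (gradient h x) (gradient ψ x)) =
        fun x => crossCLM (gradient h x) (gradient ψ x) := funext fun x => (crossCLM_apply _ _).symm
    rw [this]
    exact crossCLM.continuous₂.comp (hgradh.prodMk hgradψ)
  have ht1c : Continuous fun x => ⟪B' x, cross (gradient h x) (gradient ψ x)⟫ :=
    hB'd.continuous.inner hcrossc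
  have hK : IsCompact (closedBall (0 : EuclideanSpace ℝ (Fin 3)) M) := isCompact_closedBall 0 M
  have ht1 : Integrable (fun x => ⟪B' x, cross (gradient h x) (gradient ψ x)⟫)
      (volume : Measure (EuclideanSpace ℝ (Fin 3))) := by
    refine ht1c.integrable_of_hasCompactSupport (HasCompactSupport.intro hK fun x hx => ?_)
    rw [mem_closedBall, dist_zero_right, not_le] at hx
    simp [hgrad0 x hx.le, cross]
  have hΦcs : HasCompactSupport Φ := by
    refine HasCompactSupport.intro hK fun x hx => hΦM x ?_
    rw [mem_closedBall, dist_zero_right, not_le] at hx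
    exact hx.le
  have ht2V : Integrable (fun x => ⟪V x, Φ x⟫) (volume : Measure (EuclideanSpace ℝ (Fin 3))) :=
    integrable_inner_of_locallyIntegrable hVi hΦ1.continuous hΦcs
  have ht2ae : (fun x => ⟪curl B' x, Φ x⟫) =ᵐ[volume] fun x => ⟪V x, Φ x⟫ := by
    filter_upwards [hV] with x hx
    rw [hcurlB', hx]
  have ht2 : Integrable (fun x => ⟪curl B' x, Φ x⟫) (volume : Measure (EuclideanSpace ℝ (Fin 3))) :=
    ht2V.congr ht2ae.symm
  -- the Stokes pairing
  have hint : Integrable (fun x => ⟪B' x, curl Φ x⟫ - ⟪curl B' x, Φ x⟫)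
      (volume : Measure (EuclideanSpace ℝ (Fin 3))) := by
    simp_rw [hcurlΦ]
    exact ht1.sub ht2
  have hStokes := integral_inner_curl_sub_inner_curl_eq_zero hB'd hΦ1 hMpos hΦM hint
  simp_rw [hcurlΦ] at hStokes
  rw [integral_sub ht1 ht2, sub_eq_zero] at hStokes
  -- `∫ ⟪curl B', Φ⟫ = ∫ ⟪V, Φ⟫ = ∫ h ⟪V, ∇ψ⟫`
  rw [hStokes, integral_congr_ae ht2ae]
  refine integral_congr_ae (Eventually.of_forall fun x => ?_)
  simp only [hΦ, inner_smul_right]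

end StreamDrift

/-! ### The slice identities behind the energy estimate (Lei–Zhang 2011, §2, (2.2)–(2.3)) -/

section SliceIdentities

/-- A function of an axisymmetric scalar is axisymmetric. [folklore] -/
theorem IsAxisymmetricScalar.comp_left {F : EuclideanSpace ℝ (Fin 3) → ℝ}
    (hF : IsAxisymmetricScalar F) (H : ℝ → ℝ) : IsAxisymmetricScalar fun x => H (F x) :=
  fun θ x => by simp only [hF θ x]

/-- The gradient of a product of real functions: `∇(a c) = a ∇c + c ∇a` (a private copy of the
tree's `gradient_mul_apply` of `StokesInteriorEstimateProofs`, not imported here). [folklore] -/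
private theorem gradient_mul_apply₃ {a c : EuclideanSpace ℝ (Fin 3) → ℝ} {x : EuclideanSpace ℝ (Fin 3)}
    (ha : DifferentiableAt ℝ a x) (hc : DifferentiableAt ℝ c x) :
    gradient (fun y => a y * c y) x = a x • gradient c x + c x • gradient a x := by
  simp only [gradient, fderiv_fun_mul ha hc, map_add, map_smul]

/-- The gradient of a function of a real function: `∇(H ∘ F) = H'(F) ∇F`. [folklore] -/
theorem gradient_comp_apply {F : EuclideanSpace ℝ (Fin 3) → ℝ} {H : ℝ → ℝ}
    {x : EuclideanSpace ℝ (Fin 3)} (hH : DifferentiableAt ℝ H (F x))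
    (hF : DifferentiableAt ℝ F x) :
    gradient (fun y => H (F y)) x = deriv H (F x) • gradient F x := by
  have h := (hH.hasDerivAt.comp_hasFDerivAt x hF.hasFDerivAt).fderiv
  simp only [Function.comp_def] at h
  simp only [gradient, h, map_smul]

/-- **The viscous term** (Green's first identity with the test function `H'(F) φ²`):
`∫ ΔF · H'(F) φ² = −∫ H''(F) ‖∇F‖² φ² − ∫ H'(F) ⟪∇F, ∇(φ²)⟫` for `F ∈ C²`, `H ∈ C²`,
`φ ∈ C¹_c` — the computation "`q∬ ΔΓ |Γ|^{2q−2}Γ ψ² = −q∬((2q−1)|∇Γ|²Γ^{2q−2}ψ² + ∇ψ²·|Γ|^{2q−1}∇|Γ|)`"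
of Lei–Zhang 2011, (2.2)–(2.3), for a general `H` (there `H(v) = |v|^{2q}`). [cite: LeiZhang2011, §2 (2.2)–(2.3) (arXiv p. 6), the Laplacian term] -/
theorem integral_laplacian_mul_deriv_comp_mul_sq {F : EuclideanSpace ℝ (Fin 3) → ℝ}
    (hF : ContDiff ℝ 2 F) {H : ℝ → ℝ} (hH : ContDiff ℝ 2 H) {φ : EuclideanSpace ℝ (Fin 3) → ℝ}
    (hφ : ContDiff ℝ 1 φ) (hφc : HasCompactSupport φ) :
    ∫ x, deriv H (F x) * φ x ^ 2 * (Δ F) x =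
      -∫ x, (deriv (deriv H) (F x) * ‖gradient F x‖ ^ 2 * φ x ^ 2 +
        deriv H (F x) * ⟪gradient F x, gradient (fun y => φ y ^ 2) x⟫) := by
  have hH' : ContDiff ℝ 1 (deriv H) := by
    have h2 : ContDiff ℝ (1 + 1) H := by rw [one_add_one_eq_two]; exact hH
    exact h2.deriv'
  have hσ1 : ContDiff ℝ 1 fun x => deriv H (F x) * φ x ^ 2 :=
    (hH'.comp (hF.of_le one_le_two)).mul (hφ.pow 2)
  have hφ2c : HasCompactSupport fun y => φ y ^ 2 :=
    hφc.comp_left (g := fun t : ℝ => t ^ 2) (by simp)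
  have hσc : HasCompactSupport fun x => deriv H (F x) * φ x ^ 2 := hφ2c.mul_left
  rw [integral_mul_laplacian_eq_neg_integral_inner_gradient hσ1 hσc hF]
  congr 1
  refine integral_congr_ae (Eventually.of_forall fun x => ?_)
  have hdH : DifferentiableAt ℝ (fun y => deriv H (F y)) x :=
    ((hH'.differentiable one_ne_zero) (F x)).comp x ((hF.differentiable two_ne_zero) x)
  have hdφ2 : DifferentiableAt ℝ (fun y => φ y ^ 2) x :=
    (((hφ.differentiable one_ne_zero) x).pow 2)
  simp only []
  rw [gradient_mul_apply₃ hdH hdφ2, gradient_comp_apply ((hH'.differentiable one_ne_zero) (F x))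
    ((hF.differentiable two_ne_zero) x)]
  simp only [inner_add_left, inner_smul_left, conj_trivial, real_inner_self_eq_norm_sq]
  rw [real_inner_comm (gradient F x) (gradient (fun y => φ y ^ 2) x)]
  ring

/-- **The drift term** for a drift with a stream function:
`∫ ⟪b, ∇F⟫ H'(F) φ² = −∫ H(F) ⟪b, ∇(φ²)⟫` when `b = curl B` a.e. for a differentiable `B`
(`b` locally integrable), `F, H ∈ C²`, `φ ∈ C²_c`: the field `b` is weakly divergence free
(`∫ ⟪b, ∇θ⟫ = 0` for `θ = H(F)φ² ∈ C²_c`, by the Stokes pairing with `∇1 = 0`,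
`integral_mul_inner_gradient_eq_integral_inner_sub_cross`) and `∇θ = φ² H'(F)∇F + H(F)∇φ²`
— the step "by the divergence-free property of `b`" of Lei–Zhang 2011, (2.3), before the `bᵢ`
are estimated. [cite: LeiZhang2011, §2 (2.3) (arXiv p. 6), the transport term] -/
theorem integral_inner_gradient_mul_deriv_comp_mul_sq
    {Bst : EuclideanSpace ℝ (Fin 3) → EuclideanSpace ℝ (Fin 3)} (hBst : Differentiable ℝ Bst)
    {b : EuclideanSpace ℝ (Fin 3) → EuclideanSpace ℝ (Fin 3)} (hb : curl Bst =ᵐ[volume] b)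
    (hbi : LocallyIntegrable b volume) {F : EuclideanSpace ℝ (Fin 3) → ℝ} (hF : ContDiff ℝ 2 F)
    {H : ℝ → ℝ} (hH : ContDiff ℝ 2 H) {φ : EuclideanSpace ℝ (Fin 3) → ℝ} (hφ : ContDiff ℝ 2 φ)
    (hφc : HasCompactSupport φ) :
    ∫ x, ⟪b x, gradient F x⟫ * (deriv H (F x) * φ x ^ 2) =
      -∫ x, H (F x) * ⟪b x, gradient (fun y => φ y ^ 2) x⟫ := by
  -- the test function `θ = H(F) φ²`
  set θ : EuclideanSpace ℝ (Fin 3) → ℝ := fun y => H (F y) * φ y ^ 2 with hθ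
  have hθ2 : ContDiff ℝ 2 θ := (hH.comp hF).mul (hφ.pow 2)
  have hφ2c : HasCompactSupport fun y => φ y ^ 2 :=
    hφc.comp_left (g := fun t : ℝ => t ^ 2) (by simp)
  have hθc : HasCompactSupport θ := hφ2c.mul_left
  -- `∫ ⟪b, ∇θ⟫ = 0`
  have hzero : ∫ x, (1 : ℝ) * ⟪b x, gradient θ x⟫ = 0 := by
    rw [integral_mul_inner_gradient_eq_integral_inner_sub_cross hBst hb hbi contDiff_const hθ2
      hθc 0]
    simp [cross]
  simp only [one_mul] at hzero
  -- `∇θ = φ² H'(F) ∇F + H(F) ∇φ²`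
  have hgradθ : ∀ x, gradient θ x =
      (deriv H (F x) * φ x ^ 2) • gradient F x + H (F x) • gradient (fun y => φ y ^ 2) x := by
    intro x
    have hHF : DifferentiableAt ℝ (fun y => H (F y)) x :=
      ((hH.differentiable two_ne_zero) (F x)).comp x ((hF.differentiable two_ne_zero) x)
    have hφ2 : DifferentiableAt ℝ (fun y => φ y ^ 2) x := ((hφ.differentiable two_ne_zero) x).pow 2
    rw [hθ, gradient_mul_apply₃ hHF hφ2,
      gradient_comp_apply ((hH.differentiable two_ne_zero) (F x))
        ((hF.differentiable two_ne_zero) x), smul_smul, add_comm, mul_comm]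
  -- integrability of the two pieces
  have hgradF : Continuous (gradient F) := continuous_gradient_of_contDiff (hF.of_le one_le_two)
  have hgradφ2 : Continuous (gradient fun y => φ y ^ 2) :=
    continuous_gradient_of_contDiff ((hφ.pow 2).of_le one_le_two)
  have hc1 : Continuous fun x => (deriv H (F x) * φ x ^ 2) • gradient F x :=
    (((hH.continuous_deriv (by norm_num)).comp hF.continuous).mul (hφ.continuous.pow 2)).smul hgradF
  have hc2 : Continuous fun x => H (F x) • gradient (fun y => φ y ^ 2) x :=
    (hH.continuous.comp hF.continuous).smul hgradφ2
  have hK : IsCompact (tsupport φ) := hφc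
  have hcs1 : HasCompactSupport fun x => (deriv H (F x) * φ x ^ 2) • gradient F x := by
    refine HasCompactSupport.intro hK fun x hx => ?_
    simp [image_eq_zero_of_notMem_tsupport hx]
  have hcs2 : HasCompactSupport fun x => H (F x) • gradient (fun y => φ y ^ 2) x := by
    refine HasCompactSupport.intro hK fun x hx => ?_
    have : gradient (fun y => φ y ^ 2) x = 0 := by
      refine gradient_eq_zero_of_notMem_tsupport fun h => hx ?_
      exact (tsupport_smul_subset_left (fun y => φ y) (fun y => φ y)) (by simpa [sq] using h)
    simp [this]
  have hi1 : Integrable (fun x => ⟪b x, (deriv H (F x) * φ x ^ 2) • gradient F x⟫)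
      (volume : Measure (EuclideanSpace ℝ (Fin 3))) :=
    integrable_inner_of_locallyIntegrable hbi hc1 hcs1
  have hi2 : Integrable (fun x => ⟪b x, H (F x) • gradient (fun y => φ y ^ 2) x⟫)
      (volume : Measure (EuclideanSpace ℝ (Fin 3))) :=
    integrable_inner_of_locallyIntegrable hbi hc2 hcs2
  -- split `∫ ⟪b, ∇θ⟫` and read off
  have hsplit : ∫ x, ⟪b x, gradient θ x⟫ =
      (∫ x, ⟪b x, (deriv H (F x) * φ x ^ 2) • gradient F x⟫) +
        ∫ x, ⟪b x, H (F x) • gradient (fun y => φ y ^ 2) x⟫ := by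
    rw [← integral_add hi1 hi2]
    refine integral_congr_ae (Eventually.of_forall fun x => ?_)
    simp only [hgradθ x, inner_add_right]
  rw [hsplit] at hzero
  have e1 : ∫ x, ⟪b x, gradient F x⟫ * (deriv H (F x) * φ x ^ 2) =
      ∫ x, ⟪b x, (deriv H (F x) * φ x ^ 2) • gradient F x⟫ :=
    integral_congr_ae (Eventually.of_forall fun x => by simp only [inner_smul_right]; ring)
  have e2 : ∫ x, H (F x) * ⟪b x, gradient (fun y => φ y ^ 2) x⟫ =
      ∫ x, ⟪b x, H (F x) • gradient (fun y => φ y ^ 2) x⟫ :=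
    integral_congr_ae (Eventually.of_forall fun x => by simp only [inner_smul_right])
  rw [e1, e2]
  linarith

/-- **The axis term** (integration by parts in `r` against `1/r`, using `F = 0` on the axis
and `H(0) = 0`): `∫ (2/r) ∂ᵣF · H'(F) φ² = −∫ (2/r) H(F) ∂ᵣ(φ²)` for axisymmetric `F ∈ C¹`
vanishing on the axis, `H ∈ C¹` with `H(0) = 0`, and an axisymmetric cut-off `φ ∈ C¹_c` — the
step "by the fact that `Γ = 0` on the axis `r = 0`, `∬ (1/r)∂ᵣf² ψ² = ∬ f² ∂ᵣψ² dr dz dθ ds`" of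
Lei–Zhang 2011, (2.3) (the tree's `integral_two_div_cylRadius_mul_fderiv_eR` applied to
`H ∘ F`). [cite: LeiZhang2011, §2 (2.3) (arXiv p. 6), the axis term] -/
theorem integral_two_div_cylRadius_mul_fderiv_eR_mul_deriv_comp_mul_sq
    {F : EuclideanSpace ℝ (Fin 3) → ℝ} (hF : ContDiff ℝ 1 F) (hFa : IsAxisymmetricScalar F)
    (hF0 : ∀ x, cylRadius x = 0 → F x = 0) {H : ℝ → ℝ} (hH : ContDiff ℝ 1 H) (hH0 : H 0 = 0)
    {φ : EuclideanSpace ℝ (Fin 3) → ℝ} (hφ : ContDiff ℝ 1 φ) (hφc : HasCompactSupport φ)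
    (hφa : IsAxisymmetricScalar φ) :
    ∫ x, 2 / cylRadius x * (fderiv ℝ F x (eR x) * (deriv H (F x) * φ x ^ 2)) =
      -∫ x, 2 / cylRadius x * (H (F x) * fderiv ℝ (fun y => φ y ^ 2) x (eR x)) := by
  have hHF : ContDiff ℝ 1 fun x => H (F x) := hH.comp hF
  have hHFa : IsAxisymmetricScalar fun x => H (F x) := hFa.comp_left H
  have hHF0 : ∀ x, cylRadius x = 0 → H (F x) = 0 := fun x hx => by rw [hF0 x hx, hH0]
  have hφ2 : ContDiff ℝ 1 fun y => φ y ^ 2 := hφ.pow 2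
  have hφ2c : HasCompactSupport fun y => φ y ^ 2 :=
    hφc.comp_left (g := fun t : ℝ => t ^ 2) (by simp)
  have hφ2a : IsAxisymmetricScalar fun y => φ y ^ 2 := fun θ x => by simp only [hφa θ x]
  have h := integral_two_div_cylRadius_mul_fderiv_eR hHF hφ2 hφ2c hHFa hφ2a hHF0
  rw [← h]
  refine integral_congr_ae (Eventually.of_forall fun x => ?_)
  have hd : fderiv ℝ (fun y => H (F y)) x = deriv H (F x) • fderiv ℝ F x :=
    ((((hH.differentiable one_ne_zero) (F x)).hasDerivAt).comp_hasFDerivAt x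
      ((hF.differentiable one_ne_zero) x).hasFDerivAt).fderiv
  simp only [hd, FunLike.coe_smul, Pi.smul_apply, smul_eq_mul]
  ring

end SliceIdentities

/-! ### Steps (2)–(3) of the printed proof, and the reduction of the fact to step (1) -/

section Liouville

/-- **Lei–Zhang 2011, Theorem 1.2, for solutions already known to be swirl free** (steps
(2)–(3) of the printed proof, arXiv:1011.5066 p. 12: "Hence `v` is a bounded, weak ancient
solution without swirl. According to Theorem 5.2 in [KNSS], the ancient solution
`v = (0, 0, l(t))` … The classical Liouville theorem shows that the stream function `B`, being a
bounded function, is constant. Therefore `v = ∇ × B = 0`."). For a bounded weak solution `u`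
of Navier–Stokes (`ν = 1`) on `(−∞, 0) × ℝ³` with a.e.-axisymmetric, a.e.-swirl-free slices and
a stream function with differentiable slices, `curl (B t) = u t` a.e. and `‖B t‖_BMO ≤ C` for
a.e. `t < 0`, one has `u t = 0` a.e. for a.e. `t < 0`: KNSS Theorem 5.2 (the tree's theorem
`KNSS2009_liouville_axisymmetric_no_swirl_holds`) gives `u t = β(t) e_z` a.e., so
`(curl (B t))₂ = β(t)` a.e., and `eq_zero_of_ae_curl_apply_two_eq_of_eBMOSeminormVec_le` gives
`β(t) = 0`. [cite: LeiZhang2011, Thm. 1.2, proof §4 (arXiv:1011.5066 p. 12), steps 2–3] -/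
theorem LeiZhang2011_liouville_of_ae_swirl_eq_zero
    ⦃u : ℝ → EuclideanSpace ℝ (Fin 3) → EuclideanSpace ℝ (Fin 3)⦄
    (hu : IsBoundedWeakNSSolutionOn (Iio 0) isOpen_Iio 1 u)
    (haxi : ∀ θ : ℝ, ∀ᵐ t ∂(volume.restrict (Iio (0 : ℝ))),
      (fun x => u t (rotZ θ x)) =ᵐ[volume] fun x => rotZ θ (u t x))
    (hswirl : ∀ᵐ t ∂(volume.restrict (Iio (0 : ℝ))),
      swirl (u t) =ᵐ[volume] (0 : EuclideanSpace ℝ (Fin 3) → ℝ))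
    (hB : ∃ (B : ℝ → EuclideanSpace ℝ (Fin 3) → EuclideanSpace ℝ (Fin 3)) (C : ℝ≥0),
      ∀ᵐ t ∂(volume.restrict (Iio (0 : ℝ))),
      Differentiable ℝ (B t) ∧ curl (B t) =ᵐ[volume] u t ∧ eBMOSeminormVec (B t) ≤ C) :
    ∀ᵐ t ∂(volume.restrict (Iio (0 : ℝ))), u t =ᵐ[volume] 0 := by
  obtain ⟨b, -, -, hb⟩ := KNSS2009_liouville_axisymmetric_no_swirl_holds hu haxi hswirl
  obtain ⟨B, C, hBt⟩ := hB
  filter_upwards [hb, hBt] with t ht hBt'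
  obtain ⟨hdiff, hcurl, hbmo⟩ := hBt'
  have hcurl2 : ∀ᵐ x ∂(volume : Measure (EuclideanSpace ℝ (Fin 3))), curl (B t) x 2 = b t := by
    filter_upwards [hcurl, ht] with x hx hx'
    rw [hx, hx']
    simp [eZ]
  have hβ : b t = 0 := eq_zero_of_ae_curl_apply_two_eq_of_eBMOSeminormVec_le hdiff hbmo hcurl2
  filter_upwards [ht] with x hx
  simp [hx, hβ]

/-- **Reduction of `LeiZhang2011_liouville` to step (1) of its printed proof.** If every
bounded weak ancient solution satisfying the hypotheses of Theorem 1.2 (tree form) is swirl free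
a.e. — the output of the first paragraph of the printed proof (Theorem 1.1 of the paper and
`L → ∞`: "`r v^θ(x,t) = Γ(x,t) = Γ(0,0)` … the only way this can happen is `v^θ ≡ 0`",
arXiv:1011.5066 p. 12) — then `LeiZhang2011_liouville` holds, by
`LeiZhang2011_liouville_of_ae_swirl_eq_zero`. The hypothesis is stated inline (it is the
remaining content of Theorem 1.1, not vendored in the tree).
[cite: LeiZhang2011, Thm. 1.2, proof §4 (arXiv:1011.5066 p. 12), step 1] -/
theorem LeiZhang2011_liouville_of_swirl_step
    (hstep : ∀ ⦃u : ℝ → EuclideanSpace ℝ (Fin 3) → EuclideanSpace ℝ (Fin 3)⦄,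
      IsBoundedWeakNSSolutionOn (Iio 0) isOpen_Iio 1 u →
      (∀ θ : ℝ, ∀ᵐ t ∂(volume.restrict (Iio (0 : ℝ))),
        (fun x => u t (rotZ θ x)) =ᵐ[volume] fun x => rotZ θ (u t x)) →
      (∃ C : ℝ, ∀ᵐ t ∂(volume.restrict (Iio (0 : ℝ))),
        ∀ᵐ x ∂(volume : Measure (EuclideanSpace ℝ (Fin 3))), |swirl (u t) x| ≤ C) →
      (∃ (B : ℝ → EuclideanSpace ℝ (Fin 3) → EuclideanSpace ℝ (Fin 3)) (C : ℝ≥0),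
        ∀ᵐ t ∂(volume.restrict (Iio (0 : ℝ))),
          Differentiable ℝ (B t) ∧ curl (B t) =ᵐ[volume] u t ∧ eBMOSeminormVec (B t) ≤ C) →
      ∀ᵐ t ∂(volume.restrict (Iio (0 : ℝ))),
        swirl (u t) =ᵐ[volume] (0 : EuclideanSpace ℝ (Fin 3) → ℝ)) :
    LeiZhang2011_liouville :=
  fun _u hu haxi hΓ hB =>
    LeiZhang2011_liouville_of_ae_swirl_eq_zero hu haxi (hstep hu haxi hΓ hB) hB

end Liouville

end Literature.Analysis.FluidPDE
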